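import Literature.Probability.LatticeModels.LatticeLaplacianZd
import Literature.Probability.LatticeModels.LatticeGreenRiemannSum
import Literature.Probability.LatticeModels.SRWReturnFourier
import HarnessLib

/-!
# The Poisson identity for the lattice Green function of `ℤ^d` (`d ≥ 3`)

Topic `Literature/Probability/LatticeModels`; companion of `LatticeLaplacianZd.lean` (the graph
Laplacian `Δ = latticeLaplacianZd`) and `LatticeGreenFunction.lean` (the lattice Green function
`latticeGreen z = ∫_{[-π,π]^d} cos (p·z) / ε(p) dp/(2π)^d`, `ε(p) = ∑ᵢ (1 - cos pᵢ)`, which that file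
only shows to decay at infinity). We prove

* `latticeLaplacianZd_cos_sum_mul` — the Fourier symbol of the graph Laplacian:
  `Δ_x cos (p·x) = -2 ε(p) cos (p·x)`;
* `integral_brillouin_cos_sum_mul` — orthogonality `∫_{[-π,π]^d} cos (p·x) dp = (2π)^d [x = 0]`
  (`x ∈ ℤ^d`), the real part of the tree's `SRW.integral_brillouin_cexp_phase`
  (`SRWReturnFourier.lean`: `∫ e^{ip·x} dp = (2π)^d [x = 0]`), stated on the raw phase `∑ᵢ pᵢ xᵢ` of
  the integrand of `latticeGreen` (which is `SRW.phase p x` by `rfl`);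
* **`latticeLaplacianZd_latticeGreen`** — for `d ≥ 3` and every `x ∈ ℤ^d`,
  `Δ latticeGreen (x) = -2 · [x = 0]`,
  i.e. `G₀ := latticeGreen / 2` is the Green function of the graph Laplacian, `(-Δ) G₀ = δ₀`
  (`latticeLaplacianZd_half_latticeGreen`); `latticeGreen` is superharmonic on `ℤ^d` and harmonic
  off the origin. In random-walk language (`latticeGreen = d⁻¹ ∑ₙ P(Sₙ = ·)`, `Δ = 2d Δ_RW`) this is
  "`Δ G(x) = -δ(x)`" of G. Lawler, *Intersections of Random Walks* (1991), §1.5, p. 29, there derived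
  from the Markov property; here it is derived from the integral: by linearity of the Bochner
  integral (each `cos (p·z)/ε(p)` is integrable on `[-π,π]^d` for `d ≥ 3`,
  `integrableOn_greenIntegrand`) and the symbol identity,
  `Δ latticeGreen (x) = (2π)^{-d} ∫ (-2 ε(p) cos (p·x) / ε(p)) dp = -2 (2π)^{-d} ∫ cos (p·x) dp`
  (the integrands agree off the Lebesgue-null set `{p = 0}`), and orthogonality finishes;
* `setIntegral_pi_cos_div_eq_half_latticeGreen` — the bridge to the inline Brillouin-zone integral
  `G₀(x) = (2(2π)^d)⁻¹ ∫_{[-π,π]^d} cos(p·x)/∑ᵢ(1 - cos pᵢ) dp` by which route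
  `CriticalPhenomena/Ising3DConformalLimit/PerfectScreening` (items 1345–1348) writes `G₀` without
  importing this layer: it equals `latticeGreen x / 2`, so `(-Δ) G₀ = δ₀` in that form too
  (`latticeLaplacianZd_setIntegral_pi_cos_div`).

References: Lawler 1991 (bib key `Lawler1991`), §1.5, p. 29 (`ΔG = -δ`); G. F. Lawler, V. Limic,
*Random Walk: A Modern Introduction* (2010, bib key `LawlerLimic2010`), §4.1–4.3 (Green function,
`ℒG = -δ₀`). Fourier-side normalisation as in `LatticeGreenFunction.lean`
(`latticeGreen = 2 ×` the Green function of the graph Laplacian, symbol `2ε(p)`).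
-/

noncomputable section

open MeasureTheory Finset Real Filter Topology

namespace Literature.Probability.LatticeModels

variable {d : ℕ}

/-! ### The Fourier symbol of the graph Laplacian -/

/-- `∑ⱼ pⱼ (eᵢ)ⱼ = pᵢ` for the unit coordinate vector `eᵢ = Pi.single i 1 ∈ ℤ^d`. [folklore] -/
theorem sum_mul_intCast_single_one (p : Fin d → ℝ) (i : Fin d) :
    ∑ j, p j * ((Pi.single i (1 : ℤ) : Site d) j : ℝ) = p i := by
  rw [Finset.sum_eq_single i]
  · simp
  · intro j _ hji
    simp [Pi.single_eq_of_ne hji]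
  · simp

/-- The phase of a forward neighbour: `p·(x + eᵢ) = p·x + pᵢ`. [folklore] -/
theorem sum_mul_intCast_add_single (p : Fin d → ℝ) (x : Site d) (i : Fin d) :
    ∑ j, p j * ((x + Pi.single i 1 : Site d) j : ℝ) = (∑ j, p j * (x j : ℝ)) + p i := by
  simp only [Pi.add_apply, Int.cast_add, mul_add, Finset.sum_add_distrib,
    sum_mul_intCast_single_one]

/-- The phase of a backward neighbour: `p·(x - eᵢ) = p·x - pᵢ`. [folklore] -/
theorem sum_mul_intCast_sub_single (p : Fin d → ℝ) (x : Site d) (i : Fin d) :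
    ∑ j, p j * ((x - Pi.single i 1 : Site d) j : ℝ) = (∑ j, p j * (x j : ℝ)) - p i := by
  simp only [Pi.sub_apply, Int.cast_sub, mul_sub, Finset.sum_sub_distrib,
    sum_mul_intCast_single_one]

/-- **The Fourier symbol of the graph Laplacian of `ℤ^d`**: for every momentum `p`,
`Δ_x cos (p·x) = -2 ε(p) cos (p·x)`, `p·x = ∑ᵢ pᵢ xᵢ`, with `ε(p) = ∑ᵢ (1 - cos pᵢ)` the tree's
`dispersion` (`cos (a + pᵢ) + cos (a - pᵢ) = 2 cos a cos pᵢ`). This is the statement "`ε` is half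
the Fourier symbol `2 ∑ᵢ (1 - cos pᵢ)` of `-Δ` on `ℤ^d`" of the docstring of `dispersion`
(Fernández–Fröhlich–Sokal 1992, §1.2, eq. (1.20)). [folklore] -/
theorem latticeLaplacianZd_cos_sum_mul (p : Fin d → ℝ) (x : Site d) :
    latticeLaplacianZd (fun y => Real.cos (∑ j, p j * (y j : ℝ))) x =
      -2 * dispersion p * Real.cos (∑ j, p j * (x j : ℝ)) := by
  have hsum : ∑ i, (Real.cos (∑ j, p j * ((x + Pi.single i 1 : Site d) j : ℝ)) +
      Real.cos (∑ j, p j * ((x - Pi.single i 1 : Site d) j : ℝ))) =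
        2 * Real.cos (∑ j, p j * (x j : ℝ)) * ∑ i, Real.cos (p i) := by
    rw [Finset.mul_sum]
    refine Finset.sum_congr rfl fun i _ => ?_
    rw [sum_mul_intCast_add_single, sum_mul_intCast_sub_single, Real.cos_add, Real.cos_sub]
    ring
  have hdisp : dispersion p = d - ∑ i, Real.cos (p i) := by
    simp only [dispersion, Finset.sum_sub_distrib, Finset.sum_const, Finset.card_univ,
      Fintype.card_fin, nsmul_eq_mul, mul_one]
  rw [latticeLaplacianZd, hsum, hdisp]
  ring

/-! ### Orthogonality of characters on the Brillouin zone -/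

/-- **Orthogonality, real form**: `∫_{[-π,π]^d} cos (p·x) dp = (2π)^d` if `x = 0` and `= 0` otherwise
(`x ∈ ℤ^d`, `p·x = ∑ᵢ pᵢ xᵢ = SRW.phase p x`); the real part of the tree's
`SRW.integral_brillouin_cexp_phase`. [folklore] -/
theorem integral_brillouin_cos_sum_mul (x : Site d) :
    ∫ p in brillouin d, Real.cos (∑ j, p j * (x j : ℝ)) = if x = 0 then (2 * π) ^ d else 0 := by
  show ∫ p in brillouin d, Real.cos (SRW.phase p x) = _
  have hint : Integrable (fun p : Fin d → ℝ => Complex.exp (Complex.I * SRW.phase p x))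
      ((volume : Measure (Fin d → ℝ)).restrict (brillouin d)) := by
    have hc : Continuous fun p : Fin d → ℝ => Complex.exp (Complex.I * SRW.phase p x) := by
      unfold SRW.phase; fun_prop
    exact hc.continuousOn.integrableOn_compact (isCompact_brillouin d)
  have hre := integral_re hint
  simp only [RCLike.re_to_complex] at hre
  have hcos : ∀ p : Fin d → ℝ, (Complex.exp (Complex.I * SRW.phase p x)).re =
      Real.cos (SRW.phase p x) := fun p => by
    rw [mul_comm, Complex.exp_ofReal_mul_I_re]
  simp_rw [hcos] at hre
  rw [hre, SRW.integral_brillouin_cexp_phase]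
  split_ifs
  · rw [← Complex.ofReal_pow, Complex.ofReal_re]
  · rw [Complex.zero_re]

/-! ### The Poisson identity -/

/-- Lebesgue-almost every momentum is nonzero (`d ≥ 1`: Lebesgue measure on `ℝ^d` has no atoms).
[folklore] -/
theorem ae_ne_zero_volume_pi (hd : 0 < d) :
    ∀ᵐ p ∂(volume : Measure (Fin d → ℝ)), p ≠ 0 := by
  haveI : Nonempty (Fin d) := ⟨⟨0, hd⟩⟩
  have h0 : (volume : Measure (Fin d → ℝ)) {0} = 0 := measure_singleton 0
  rw [← compl_mem_ae_iff] at h0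
  filter_upwards [h0] with p hp
  simpa using hp

/-- The graph Laplacian acting on the lattice variable of the Green integrand
`h_z(p) = cos (p·z)/ε(p)`: off `ε(p) = 0`, `Δ_z h_z(p) (x) = -2 cos (p·x)`. [folklore] -/
theorem latticeLaplacianZd_greenIntegrand {p : Fin d → ℝ} (hp : dispersion p ≠ 0) (x : Site d) :
    latticeLaplacianZd (fun z => greenIntegrand z p) x = -2 * Real.cos (∑ j, p j * (x j : ℝ)) := by
  have hfun : (fun z => greenIntegrand z p) =
      fun z => (dispersion p)⁻¹ * Real.cos (∑ j, p j * (z j : ℝ)) :=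
    funext fun z => by rw [greenIntegrand, div_eq_inv_mul]
  rw [hfun, latticeLaplacianZd_const_mul, latticeLaplacianZd_cos_sum_mul]
  field_simp

variable (d) in
/-- **The Poisson identity for the lattice Green function** (`d ≥ 3`):
`Δ latticeGreen (x) = -2 · [x = 0]` for the graph Laplacian `Δ = latticeLaplacianZd` of `ℤ^d`,
i.e. `latticeGreen / 2` is the Green function of `-Δ`. Random-walk form: "`ΔG(x) = -δ(x)`",
Lawler 1991, §1.5, p. 29 (`G = ∑ⱼ pⱼ = d · latticeGreen`, `Δ_RW = (2d)⁻¹ Δ`); Lawler–Limic 2010,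
§4.1–4.3. Proof here: Fourier symbol `-2ε(p)` (`latticeLaplacianZd_cos_sum_mul`) against the
integrand `cos (p·z)/ε(p)`, linearity of the integral (`integrableOn_greenIntegrand`, `d ≥ 3`), the
integrands agreeing off the Lebesgue-null set `{p = 0}`, and orthogonality
(`integral_brillouin_cos_sum_mul`). [cite: Lawler1991, §1.5, p. 29] -/
theorem latticeLaplacianZd_latticeGreen (hd : 3 ≤ d) (x : Site d) :
    latticeLaplacianZd latticeGreen x = -2 * (if x = 0 then 1 else 0) := by
  have hI : ∀ z : Site d, Integrable (greenIntegrand z)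
      ((volume : Measure (Fin d → ℝ)).restrict (brillouin d)) :=
    fun z => integrableOn_greenIntegrand d hd z
  -- Step 1: pull the (finite) linear combination out of the integrals
  have step1 : latticeLaplacianZd latticeGreen x =
      ((∑ i, ((∫ p in brillouin d, greenIntegrand (x + Pi.single i 1) p) +
          ∫ p in brillouin d, greenIntegrand (x - Pi.single i 1) p)) -
        2 * d * ∫ p in brillouin d, greenIntegrand x p) / (2 * π) ^ d := by
    simp only [latticeLaplacianZd, latticeGreen_eq, sub_div, Finset.sum_div, add_div]
    ring
  have hF : ∀ i ∈ (univ : Finset (Fin d)), Integrable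
      (fun p => greenIntegrand (x + Pi.single i 1) p + greenIntegrand (x - Pi.single i 1) p)
      ((volume : Measure (Fin d → ℝ)).restrict (brillouin d)) := fun i _ => (hI _).add (hI _)
  have hsumI : Integrable (fun p => ∑ i, (greenIntegrand (x + Pi.single i 1) p +
      greenIntegrand (x - Pi.single i 1) p)) ((volume : Measure (Fin d → ℝ)).restrict (brillouin d)) :=
    integrable_finsetSum univ hF
  have hcI : Integrable (fun p => 2 * d * greenIntegrand x p)
      ((volume : Measure (Fin d → ℝ)).restrict (brillouin d)) := (hI x).const_mul _
  have step2 : ∫ p in brillouin d, ((∑ i, (greenIntegrand (x + Pi.single i 1) p +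
          greenIntegrand (x - Pi.single i 1) p)) - 2 * d * greenIntegrand x p) =
      (∑ i, ((∫ p in brillouin d, greenIntegrand (x + Pi.single i 1) p) +
          ∫ p in brillouin d, greenIntegrand (x - Pi.single i 1) p)) -
        2 * d * ∫ p in brillouin d, greenIntegrand x p := by
    rw [integral_sub hsumI hcI, integral_finsetSum univ hF, integral_const_mul]
    congr 1
    exact Finset.sum_congr rfl fun i _ => integral_add (hI _) (hI _)
  -- Step 2: the integrand is `Δ_z h_z(p) (x) = -2 cos (p·x)` off the null set `{p = 0}`
  have hae : ∀ᵐ p ∂((volume : Measure (Fin d → ℝ)).restrict (brillouin d)),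
      ((∑ i, (greenIntegrand (x + Pi.single i 1) p + greenIntegrand (x - Pi.single i 1) p)) -
        2 * d * greenIntegrand x p) = -2 * Real.cos (∑ j, p j * (x j : ℝ)) := by
    have h0 := ae_restrict_of_ae (s := brillouin d) (ae_ne_zero_volume_pi (d := d) (by omega))
    have hB : ∀ᵐ p ∂((volume : Measure (Fin d → ℝ)).restrict (brillouin d)), p ∈ brillouin d :=
      ae_restrict_mem (measurableSet_brillouin d)
    filter_upwards [h0, hB] with p hp0 hpB
    have hε : dispersion p ≠ 0 := (dispersion_pos_of_mem_brillouin hpB hp0).ne'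
    have key := latticeLaplacianZd_greenIntegrand hε x
    simp only [latticeLaplacianZd] at key
    exact key
  -- Step 3: orthogonality
  rw [step1, ← step2, integral_congr_ae hae, integral_const_mul, integral_brillouin_cos_sum_mul]
  have hπ : (2 * π) ^ d ≠ 0 := by positivity
  split_ifs
  · rw [mul_div_assoc, div_self hπ]
  · rw [mul_zero, zero_div]

variable (d) in
/-- `Δ latticeGreen (x) = 0` for `x ≠ 0` (`d ≥ 3`): the lattice Green function is harmonic off the
origin. [cite: Lawler1991, §1.5, p. 29] -/
theorem latticeLaplacianZd_latticeGreen_of_ne_zero (hd : 3 ≤ d) {x : Site d} (hx : x ≠ 0) :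
    latticeLaplacianZd latticeGreen x = 0 := by
  rw [latticeLaplacianZd_latticeGreen d hd x, if_neg hx, mul_zero]

variable (d) in
/-- `Δ latticeGreen (0) = -2` (`d ≥ 3`). [cite: Lawler1991, §1.5, p. 29] -/
theorem latticeLaplacianZd_latticeGreen_zero (hd : 3 ≤ d) :
    latticeLaplacianZd latticeGreen (0 : Site d) = -2 := by
  rw [latticeLaplacianZd_latticeGreen d hd 0, if_pos rfl, mul_one]

variable (d) in
/-- **`(-Δ) G₀ = δ₀`** for `G₀ := latticeGreen / 2`, the Green function of the graph Laplacian of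
`ℤ^d` (`d ≥ 3`). [cite: Lawler1991, §1.5, p. 29] -/
theorem latticeLaplacianZd_half_latticeGreen (hd : 3 ≤ d) (x : Site d) :
    latticeLaplacianZd (fun z => latticeGreen z / 2) x = -(if x = 0 then 1 else 0) := by
  have h : (fun z : Site d => latticeGreen z / 2) = fun z => (1 / 2 : ℝ) * latticeGreen z := by
    funext z; ring
  rw [h, latticeLaplacianZd_const_mul, latticeLaplacianZd_latticeGreen d hd x]
  ring

variable (d) in
/-- The lattice Green function is harmonic on `ℤ^d ∖ {0}` (`d ≥ 3`). [cite: Lawler1991, §1.5, p. 29] -/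
theorem isZdHarmonicOn_latticeGreen (hd : 3 ≤ d) :
    IsZdHarmonicOn (latticeGreen (d := d)) {0}ᶜ := fun _ hx =>
  latticeLaplacianZd_latticeGreen_of_ne_zero d hd hx

variable (d) in
/-- The lattice Green function is superharmonic on all of `ℤ^d` (`d ≥ 3`): `Δ latticeGreen ≤ 0`.
[cite: Lawler1991, §1.5, p. 29] -/
theorem isZdSuperharmonicOn_latticeGreen (hd : 3 ≤ d) :
    IsZdSuperharmonicOn (latticeGreen (d := d)) Set.univ := fun x _ => by
  rw [latticeLaplacianZd_latticeGreen d hd x]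
  split_ifs <;> norm_num

/-! ### The inline Brillouin-zone integral of route `PerfectScreening` -/

/-- **Bridge to the inline form**: the Brillouin-zone integral
`(2(2π)^d)⁻¹ ∫_{[-π,π]^d} cos (∑ᵢ pᵢ xᵢ) / ∑ᵢ (1 - cos pᵢ) dp` by which route
`CriticalPhenomena/Ising3DConformalLimit/PerfectScreening` (items 1345–1348) writes the Green
function `G₀` of the graph Laplacian is `latticeGreen x / 2` (definitional unfolding of
`brillouin` and `dispersion`). [folklore] -/
theorem setIntegral_pi_cos_div_eq_half_latticeGreen (x : Site d) :
    (∫ p in Set.pi Set.univ (fun _ : Fin d => Set.Icc (-Real.pi) Real.pi),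
        Real.cos (∑ i, p i * (x i : ℝ)) / (∑ i, (1 - Real.cos (p i)))) / (2 * (2 * Real.pi) ^ d) =
      latticeGreen x / 2 := by
  rw [latticeGreen, div_div, mul_comm ((2 * π) ^ d) 2]
  rfl

variable (d) in
/-- **`(-Δ) G₀ = δ₀` in the inline form** (`d ≥ 3`): the graph Laplacian of
`x ↦ (2(2π)^d)⁻¹ ∫_{[-π,π]^d} cos (p·x) / ∑ᵢ (1 - cos pᵢ) dp` is `-[x = 0]`. This is "the lattice
Poisson identity `6G₀(x) − ΣG₀(x±eᵢ) = δ₀(x)`" wanted by route `PerfectScreening` (rationale and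
items 1346–1347) for `d = 3`. [cite: Lawler1991, §1.5, p. 29] -/
theorem latticeLaplacianZd_setIntegral_pi_cos_div (hd : 3 ≤ d) (x : Site d) :
    latticeLaplacianZd (fun z : Site d =>
        (∫ p in Set.pi Set.univ (fun _ : Fin d => Set.Icc (-Real.pi) Real.pi),
          Real.cos (∑ i, p i * (z i : ℝ)) / (∑ i, (1 - Real.cos (p i)))) / (2 * (2 * Real.pi) ^ d))
      x = -(if x = 0 then 1 else 0) := by
  have h : (fun z : Site d =>
      (∫ p in Set.pi Set.univ (fun _ : Fin d => Set.Icc (-Real.pi) Real.pi),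
        Real.cos (∑ i, p i * (z i : ℝ)) / (∑ i, (1 - Real.cos (p i)))) / (2 * (2 * Real.pi) ^ d)) =
      fun z => latticeGreen z / 2 :=
    funext fun z => setIntegral_pi_cos_div_eq_half_latticeGreen z
  rw [h, latticeLaplacianZd_half_latticeGreen d hd x]

end Literature.Probability.LatticeModels
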